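import Summits.ABC.StewartYu.DescentLevelsThirdQ
import Summits.ABC.StewartYu.PadicMulticubicLiouvillePadic
import Summits.ABC.StewartYu.PadicTwoFunctions
import HarnessLib

/-!
# Cell abc-stewartyu, W80Two: where the `2`-adic THIRD-POINT Liouville inequality meets the descent

`Summits/ABC/StewartYu/DescentThirdLiouvilleQ.lean` — cell `abc-stewartyu` (HOME
`run/shared/lean/pub/abc-stewartyu/`, seat p3; route `PadicPrimesW80TwoThirds`, crux `W80Two`
stmt-ABC-19486; theorems only, no named fact).  Base-`3` twin of the half-point section of p3's
`DescentLiouvilleQ.lean` (`SetupQ.classVec_eq_zero_of_padicNorm_lt`), on lit's `DescentThirdQ.lean`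
(triadic class sums `classVec3`, their denominators `classVec3_den`), p2's `DescentLevelsThirdQ.lean`
(`qΔ3`, `qΔ3_third`), lit's multicubic Liouville
inequality in `ℚ_p` (`MulticubLiouville.norm_ev3_ge_padic`, INTEGER generators, cube-Kummer condition,
exponent `3^{k+1} − 1` with `k = d + 1` generators) and lit's third-point value of the auxiliary
function (`TwoSetup.Φ_third`):

* `SetupQ.classVec3_const_mul` — linearity of the class sums in the weights;
* `SetupQ.classVec3_eq_zero_of_padicNorm_lt` — place-free: for integer generators `allᵢ` with the
  cube-Kummer condition and `p`-adic cube roots `tᵢ³ = allᵢ`, `‖tᵢ‖_p ≤ 1`, if the evaluation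
  `ev3 t (classVec3 box p c s)` (weights `c(u)`, denominator `D ≥ 1` of the `c(u)·qEt(u,s)` on the
  box, `∑_κ |classVec3(κ)| ≤ M`, `M ≥ 1`) is `p`-adically smaller than
  `1/(6·D·M·∏ᵢ max(1,|allᵢ|))^{3^{d+2} − 1}`, then ALL `3^{d+1}` class sums vanish;
* `SetupQ.thirdThreshold_anti` — the threshold is antitone in `D`, `M` (uniform bounds suffice);
* `TwoSetup.norm_cbrt_le_one` — the principal `2`-adic cube roots are integral;
* `TwoSetup.Φ_third_succ`, `norm_Φ_third` — `φ_{J,τ}(s/3) = 3^{τ₀} · ev3 cbrt (classVec3_{J+1,τ,s})`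
  with the weights `qΔ3_{J₀,J+1}(u;τ₀,s)·qA(u,τ')` of p2's algebraic third step (`qΔ3_third`), hence
  `‖φ_{J,τ}(s/3)‖₂ = ‖ev3 cbrt (classVec3_{J+1,τ,s})‖₂` (`3` is a `2`-adic unit);
* `TwoSetup.classVec3_eq_zero_of_norm_Φ_third_lt` — the Liouville estimate at `p = 2` with the principal
  cube roots `cbrtᵢ` of `PadicTwoValues` and the smallness stated for `‖φ_{J,τ}(s/3)‖₂` — exactly the
  vanishing of the triadic class sums that the algebraic third step (`SetupQ.descent_algebra3`) consumes.

The integrality of the generators is carried as a HYPOTHESIS (`hint`), not as a field of the landed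
`TwoSetup` (the `abc` application has `αⱼ = qⱼ²`).  Everything is [folklore].

## References
* [Yu1989] K. Yu, *Linear forms in p-adic logarithms*, Acta Arith. 53 (1989), §3 (the `q`-descent).
* [Yu1990] K. Yu, *Linear forms in p-adic logarithms II*, Compositio Math. 74 (1990), §1.1 (`p = 2`,
  `q = 3`), §2.4 Lemma 2.5.
* [Waldschmidt1980] M. Waldschmidt, Acta Arith. 37 (1980), Lemma 3.7 (pp. 272–273).
-/

noncomputable section

open Finset
open Literature.NumberTheory.Transcendental
open Literature.NumberTheory.Transcendental.CW77.Setup (Idx Tau tauNorm)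
open Literature.NumberTheory.Transcendental.PadicCW77.Setup (DwQ)

namespace Summit.ABC.StewartYu

namespace SetupQ

variable (Q : SetupQ) {h Lb : ℕ}

/-- **The triadic class sums are linear in the weights**: `classVec3 (a·c) = a • classVec3 c`.
[folklore] -/
theorem classVec3_const_mul (box : Finset (Idx Q.d h Lb)) (pv : Idx Q.d h Lb → ℤ)
    (c : Idx Q.d h Lb → ℚ) (s : ℕ) (a : ℚ) :
    Q.classVec3 box pv (fun u => a * c u) s = a • Q.classVec3 box pv c s := by
  classical
  funext κ
  simp only [classVec3, Pi.smul_apply, smul_eq_mul, mul_sum]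
  exact sum_congr rfl fun u _ => by ring

section Padic

variable {p : ℕ} [Fact p.Prime]

/-- **The `p`-adic Liouville inequality at the third points: vanishing of the triadic class sums.**
Let the generators `allᵢ` be integers satisfying the cube-Kummer condition, with `p`-adic cube roots
`tᵢ` (`tᵢ³ = allᵢ`, `‖tᵢ‖_p ≤ 1`).  If the evaluation `ev3 t (classVec3 box p c s)` of the triadic
class-sum vector (a denominator `D ≥ 1` of the weights `c(u)·qEt(u,s)` on the box,
`∑_κ |classVec3(κ)| ≤ M`, `M ≥ 1`) is `p`-adically smaller than `1/(6·D·M·∏ᵢ max(1,|allᵢ|))^{3^{d+2}−1}`,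
then every class sum vanishes (`MulticubLiouville.norm_ev3_ge_padic`). [folklore] -/
theorem classVec3_eq_zero_of_padicNorm_lt (hint : ∀ i, ∃ a : ℤ, Q.all i = a)
    (hind : ∀ κ : Fin (Q.d + 1) → ℕ, (∃ j, ¬ 3 ∣ κ j) → ∀ γ : ℚ, ∏ j, Q.all j ^ κ j ≠ γ ^ 3)
    (t : Fin (Q.d + 1) → ℚ_[p]) (ht : ∀ i, t i ^ 3 = (Q.all i : ℚ_[p])) (ht1 : ∀ i, ‖t i‖ ≤ 1)
    (box : Finset (Idx Q.d h Lb)) (pv : Idx Q.d h Lb → ℤ) (c : Idx Q.d h Lb → ℚ) (s : ℕ)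
    {D : ℕ} (hD : 1 ≤ D) (hDc : ∀ u ∈ box, ∃ z : ℤ, (D : ℚ) * (c u * Q.qEt u s) = z)
    {M : ℝ} (hM : 1 ≤ M) (hcM : ∑ κ, |(Q.classVec3 box pv c s κ : ℝ)| ≤ M)
    (hlt : ‖Multicub.ev3 t (Q.classVec3 box pv c s)‖ <
      1 / (6 * (D : ℝ) * M * ∏ i, max 1 |(Q.all i : ℝ)|) ^ (3 ^ (Q.d + 1 + 1) - 1)) :
    Q.classVec3 box pv c s = 0 := by
  by_contra hne
  have hge := MulticubLiouville.norm_ev3_ge_padic (p := p) (Q.d + 1) Q.all hint hind t ht ht1 _ hne D hD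
    (fun κ => Q.classVec3_den box pv c s hDc κ) M hM hcM
  exact absurd hge (not_le.mpr hlt)

/-- **The third-point threshold `1/(6·D·M·P)^E` is antitone in `D` and `M`**: with `0 < D ≤ D'`,
`0 < M ≤ M'`, `0 < P`, `1/(6D'M'P)^E ≤ 1/(6DMP)^E` (lets a per-`(s,τ)` denominator `D(s,τ) ≤ Dmax` and
size `M(s,τ) ≤ Mmax` be replaced by uniform bounds). [folklore] -/
theorem thirdThreshold_anti {D D' M M' P : ℝ} (hD : 0 < D) (hDD' : D ≤ D') (hM : 0 < M) (hMM' : M ≤ M')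
    (hP : 0 < P) (E : ℕ) : 1 / (6 * D' * M' * P) ^ E ≤ 1 / (6 * D * M * P) ^ E := by
  have h0 : 0 < 6 * D * M * P := by positivity
  have hD' : 0 < D' := lt_of_lt_of_le hD hDD'
  refine one_div_le_one_div_of_le (pow_pos h0 E) (pow_le_pow_left₀ h0.le ?_ E)
  have h1 : 6 * D * M * P ≤ 6 * D' * M * P := by
    have : 0 ≤ 6 * M * P := by positivity
    nlinarith
  have h2 : 6 * D' * M * P ≤ 6 * D' * M' * P := by
    have : 0 ≤ 6 * D' * P := by positivity
    nlinarith
  linarith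

end Padic

end SetupQ

namespace TwoSetup

variable (S : TwoSetup) {h Lb : ℕ}

/-- The principal cube roots are `2`-adic integers: `‖cbrtᵢ‖₂ ≤ 1`. [folklore] -/
theorem norm_cbrt_le_one (i : Fin (S.d + 1)) : ‖S.cbrt i‖ ≤ 1 := by
  have h1 := S.norm_cbrt_pow i 1
  rw [pow_one] at h1
  exact h1.le

/-- `cbrtᵢ³ = allᵢ` (cast form). [folklore] -/
theorem cbrt_pow_three_cast (i : Fin (S.d + 1)) : S.cbrt i ^ 3 = (S.toQ.all i : ℚ_[2]) :=
  S.cbrt_pow_three i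

omit S in
/-- `3` is a `2`-adic unit: `‖3^τ₀‖₂ = 1`. [folklore] -/
theorem norm_ratCast_three_pow (τ₀ : ℕ) : ‖(((3 : ℚ) ^ τ₀ : ℚ) : ℚ_[2])‖ = 1 := by
  have h3 : ‖((3 : ℕ) : ℚ_[2])‖ = 1 := by
    have := TwoAdic.norm_inv_three_two
    rwa [norm_inv, inv_eq_one] at this
  have e : (((3 : ℚ) ^ τ₀ : ℚ) : ℚ_[2]) = ((3 : ℕ) : ℚ_[2]) ^ τ₀ := by push_cast; ring
  rw [e, norm_pow, h3, one_pow]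

/-- **The value of `φ_{J,τ}` at the third point `s/3`, at the weights of the NEXT level** (`J < J₀`):
`φ_{J,τ}(s/3) = 3^{τ₀} · ev3 cbrt (classVec3_{J+1,τ,s})`, the class sums being taken with the weights
`qΔ3_{J₀,J+1}(u; τ₀, s) · qA(u, τ')` of the algebraic third step (lit's `Φ_third` and p2's
`qΔ3_third`: `Δ(s/3)` at level `J` is `3^{τ₀} Δ(s)` at level `J+1`). [cite: Yu1989, §3] -/
theorem Φ_third_succ {J₀ J : ℕ} (hJ : J < J₀) (box : Finset (Idx S.d h Lb)) (pv : Idx S.d h Lb → ℤ)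
    (τ : Tau S.d) (s : ℕ) :
    S.Φ J₀ J box pv τ ((s : ℚ_[2]) * ((3 : ℕ) : ℚ_[2])⁻¹) =
      (((3 : ℚ) ^ τ.1 : ℚ) : ℚ_[2]) *
        Multicub.ev3 S.cbrt
          (S.toQ.classVec3 box pv (fun u => S.toQ.qΔ3 J₀ (J + 1) u τ.1 s * S.frame.qA u τ.2) s) := by
  have hc : (fun u : Idx S.d h Lb =>
      DwQ (3 ^ (J₀ - J)) (u.1.1 : ℕ) (u.1.2 : ℕ) h τ.1 ((s : ℚ) / 3) * S.frame.qA u τ.2) =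
      fun u => (3 : ℚ) ^ τ.1 * (S.toQ.qΔ3 J₀ (J + 1) u τ.1 s * S.frame.qA u τ.2) := by
    funext u; rw [S.toQ.qΔ3_third hJ]; ring
  rw [S.Φ_third, hc, S.toQ.classVec3_const_mul, Multicub.ev3_smul]

/-- **`‖φ_{J,τ}(s/3)‖₂ = ‖ev3 cbrt (classVec3_{J+1,τ,s})‖₂`** (`3` is a `2`-adic unit). [folklore] -/
theorem norm_Φ_third {J₀ J : ℕ} (hJ : J < J₀) (box : Finset (Idx S.d h Lb)) (pv : Idx S.d h Lb → ℤ)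
    (τ : Tau S.d) (s : ℕ) :
    ‖S.Φ J₀ J box pv τ ((s : ℚ_[2]) * ((3 : ℕ) : ℚ_[2])⁻¹)‖ =
      ‖Multicub.ev3 S.cbrt
        (S.toQ.classVec3 box pv (fun u => S.toQ.qΔ3 J₀ (J + 1) u τ.1 s * S.frame.qA u τ.2) s)‖ := by
  rw [S.Φ_third_succ hJ, norm_mul, norm_ratCast_three_pow, one_mul]

/-- **The `2`-adic Liouville estimate at the third points** (twin of
`TwistSetup.classVec_eq_zero_of_norm_Φ_half_lt`; `J < J₀`): integer generators with the cube-Kummer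
condition; if the weights `qΔ3_{J₀,J+1}(u;τ₀,s)·qA(u,τ')` times `qEt(u,s)` have the denominator `D ≥ 1`
on the box, `∑_κ |classVec3(κ)| ≤ M` (`M ≥ 1`) and
`‖φ_{J,τ}(s/3)‖₂ < 1/(6·D·M·∏ᵢ max(1,|allᵢ|))^{3^{d+2}−1}`, then the triadic class-sum vector at
`(J+1, τ, s)` vanishes — the `third`-hypothesis of the algebraic third step. [folklore] -/
theorem classVec3_eq_zero_of_norm_Φ_third_lt (hint : ∀ i, ∃ a : ℤ, S.toQ.all i = a)
    (hind : ∀ κ : Fin (S.d + 1) → ℕ, (∃ j, ¬ 3 ∣ κ j) → ∀ γ : ℚ, ∏ j, S.toQ.all j ^ κ j ≠ γ ^ 3)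
    {J₀ J : ℕ} (hJ : J < J₀) (box : Finset (Idx S.d h Lb)) (pv : Idx S.d h Lb → ℤ) (τ : Tau S.d)
    (s : ℕ) {D : ℕ} (hD : 1 ≤ D)
    (hDc : ∀ u ∈ box, ∃ z : ℤ, (D : ℚ) *
      ((S.toQ.qΔ3 J₀ (J + 1) u τ.1 s * S.frame.qA u τ.2) * S.toQ.qEt u s) = z)
    {M : ℝ} (hM : 1 ≤ M)
    (hcM : ∑ κ, |(S.toQ.classVec3 box pv
      (fun u => S.toQ.qΔ3 J₀ (J + 1) u τ.1 s * S.frame.qA u τ.2) s κ : ℝ)| ≤ M)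
    (hlt : ‖S.Φ J₀ J box pv τ ((s : ℚ_[2]) * ((3 : ℕ) : ℚ_[2])⁻¹)‖ <
      1 / (6 * (D : ℝ) * M * ∏ i, max 1 |(S.toQ.all i : ℝ)|) ^ (3 ^ (S.d + 1 + 1) - 1)) :
    S.toQ.classVec3 box pv (fun u => S.toQ.qΔ3 J₀ (J + 1) u τ.1 s * S.frame.qA u τ.2) s = 0 := by
  rw [S.norm_Φ_third hJ] at hlt
  exact S.toQ.classVec3_eq_zero_of_padicNorm_lt hint hind S.cbrt S.cbrt_pow_three_cast S.norm_cbrt_le_one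
    box pv _ s hD hDc hM hcM hlt

end TwoSetup

end Summit.ABC.StewartYu

end
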